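import Summits.QuantumFields.GaugeBoot.TwistedSlabFourLink
import HarnessLib

/-!
# Strong-coupling pair terms on a periodic lattice (gauge-boot, L3 supplement: reduced-half in-plane mirrors, 1/7)

HONEST FRAMING (cell `pub-gaugeboot`, page 1 of every file): the venture produces certified bounds
on lattice expectations at stated coupling, gauge group, dimension and torus size; NOT a mass gap,
NOT a continuum limit, NOT a string tension; NOT Yang–Mills-summit-bearing (barriers
`FixedCouplingUltralocality`, `PerturbativeInvisibility`). This module is bookkeeping for a small
structural NEGATIVE result (the REDUCED-half in-plane mirrors of the square tilted boxes are not of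
positive type in `d ≥ 3` at small coupling); it discharges nothing by itself.

## Content (any finite periodic lattice `(A, e)` of `TiltedLatticeGauge.lean`, compact `G`, continuous `ρ`)

The periodic-lattice version of the torus bookkeeping `DiagonalRPTorusTubeTerms.lean` (which is
written for the cubic torus `GaugeConfig d L` only):

* `gfac ρ e β q U = e^{β Re tr ρ(U_q)} - 1` (the plaquette factor of the strong-coupling / cluster
  expansion `∏_q e^{β Re tr ρ(U_q)} = ∑_{Q} ∏_{q ∈ Q} g_q`, `prod_exp_eq_sum_prod_gfac`), with
  `|g_q| ≤ 2βN` and `|g_q - β Re tr ρ(U_q)| ≤ (βN)²` for `0 ≤ β`, `βN ≤ 1`;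
* the PAIR TERM `pairT ρ e β Q u v = ∫ Re tr ρ(U_u) Re tr ρ(U_v) ∏_{q ∈ Q} g_q ∏ dU` of two
  plaquettes `u, v` (product Haar measure), `pairT_comm`, the crude bound
  **`abs_pairT_le`** `|T_Q(u,v)| ≤ N² (2βN)^{|Q|}`;
* **`integral_diff_mul_diff_restW_eq_sum`** — for four plaquettes `a, b, c, c'` and a finite set
  `R` of "rest" plaquettes,
  `∫ (W_a - W_b)(W_c - W_c') ∏_{q ∈ R} e^{β W_q} ∏ dU
     = ∑_{Q ⊆ R} (T_Q(a,c) - T_Q(a,c') - T_Q(b,c) + T_Q(b,c'))`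
  (`W_p = Re tr ρ(U_p)`); this is the shape of the "trick form" of a plaquette-difference witness
  once the half-action trick has cancelled every Boltzmann factor outside `R`;
* the tail bound **`abs_sum_pairT_filter_lt_card_le`**
  `|∑_{Q ⊆ R, n < |Q|} T_Q(u,v)| ≤ 2^{|R|} N² (2βN)^{n+1}` (`2βN ≤ 1`).

Elementary strong-coupling bookkeeping (cf. M. Creutz, *Quarks, gluons and lattices* (1983) §10;
I. Montvay, G. Münster, *Quantum Fields on a Lattice* (1994) §3.4); no definition of record, no
named fact. The lonely-link reduction and the centre-twist vanishing follow in
`PeriodicPairPeel.lean`.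
-/

noncomputable section

open MeasureTheory Finset
open Literature.MathematicalPhysics.QuantumFieldTheory (haarProbability)
open Literature.RepresentationTheory.CompactGroups

namespace Summit.QuantumFields.GaugeBoot

namespace TiltedRP

namespace PairExp

variable {A : Type*} [AddCommGroup A] [Fintype A] {d N : ℕ} {G : Type*} [Group G]
  [TopologicalSpace G] [IsTopologicalGroup G] [CompactSpace G] [MeasurableSpace G] [BorelSpace G]
  [SecondCountableTopology G] (ρ : G →* Matrix (Fin N) (Fin N) ℂ) (e : Fin d → A) (β : ℝ)

/-! ## Plaquette factors and pair terms -/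

/-- The plaquette factor `g_q(U) = e^{β Re tr ρ(U_q)} - 1` of the strong-coupling expansion on the
periodic lattice `(A, e)`. [folklore] -/
def gfac (q : Plaq A d) (U : Config A d G) : ℝ :=
  Real.exp (β * plaqObs ρ e q U) - 1

/-- THE PAIR TERM `T_Q(u,v) = ∫ Re tr ρ(U_u) Re tr ρ(U_v) ∏_{q ∈ Q} g_q ∏ dU` of two plaquettes
`u, v` against the product Haar measure. [folklore] -/
def pairT (Q : Finset (Plaq A d)) (u v : Plaq A d) : ℝ :=
  ∫ U, plaqObs ρ e u U * plaqObs ρ e v U * ∏ q ∈ Q, gfac ρ e β q U ∂(productHaar A d G)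

/-- The rest weight `∏_{q ∈ R} e^{β Re tr ρ(U_q)}`. [folklore] -/
def restW (R : Finset (Plaq A d)) (U : Config A d G) : ℝ :=
  ∏ q ∈ R, Real.exp (β * plaqObs ρ e q U)

omit [Fintype A] [MeasurableSpace G] [BorelSpace G] [SecondCountableTopology G] in
/-- `|g_q| ≤ 2βN` for `0 ≤ β`, `βN ≤ 1`. [folklore] -/
theorem abs_gfac_le (hρ : Continuous ρ) (hβ : 0 ≤ β) (hβN : β * N ≤ 1) (q : Plaq A d)
    (U : Config A d G) : |gfac ρ e β q U| ≤ 2 * β * N := by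
  have hx : |β * plaqObs ρ e q U| ≤ β * N := by
    rw [abs_mul, abs_of_nonneg hβ]
    exact mul_le_mul_of_nonneg_left (abs_plaqObs_le ρ hρ e q U) hβ
  unfold gfac
  calc |Real.exp (β * plaqObs ρ e q U) - 1| ≤ 2 * |β * plaqObs ρ e q U| :=
        Real.abs_exp_sub_one_le (hx.trans hβN)
    _ ≤ 2 * (β * N) := by linarith
    _ = 2 * β * N := by ring

omit [Fintype A] [MeasurableSpace G] [BorelSpace G] [SecondCountableTopology G] in
/-- `|g_q - β Re tr ρ(U_q)| ≤ (βN)²` for `0 ≤ β`, `βN ≤ 1`. [folklore] -/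
theorem abs_gfac_sub_le (hρ : Continuous ρ) (hβ : 0 ≤ β) (hβN : β * N ≤ 1) (q : Plaq A d)
    (U : Config A d G) : |gfac ρ e β q U - β * plaqObs ρ e q U| ≤ (β * N) ^ 2 := by
  have hx : |β * plaqObs ρ e q U| ≤ β * N := by
    rw [abs_mul, abs_of_nonneg hβ]
    exact mul_le_mul_of_nonneg_left (abs_plaqObs_le ρ hρ e q U) hβ
  have hx1 : |β * plaqObs ρ e q U| ≤ 1 := hx.trans hβN
  unfold gfac
  calc |Real.exp (β * plaqObs ρ e q U) - 1 - β * plaqObs ρ e q U|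
      ≤ (β * plaqObs ρ e q U) ^ 2 := Real.abs_exp_sub_one_sub_id_le hx1
    _ = |β * plaqObs ρ e q U| ^ 2 := (sq_abs _).symm
    _ ≤ (β * N) ^ 2 := pow_le_pow_left₀ (abs_nonneg _) hx 2

omit [Fintype A] [CompactSpace G] [MeasurableSpace G] [BorelSpace G] [SecondCountableTopology G] in
/-- The plaquette factor is continuous. [folklore] -/
theorem continuous_gfac (hρ : Continuous ρ) (q : Plaq A d) :
    Continuous (gfac ρ e β q : Config A d G → ℝ) := by
  unfold gfac
  exact (Real.continuous_exp.comp (continuous_const.mul (continuous_plaqObs ρ hρ e q))).sub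
    continuous_const

omit [Fintype A] [CompactSpace G] [MeasurableSpace G] [BorelSpace G] [SecondCountableTopology G] in
/-- The rest weight is continuous. [folklore] -/
theorem continuous_restW (hρ : Continuous ρ) (R : Finset (Plaq A d)) :
    Continuous (restW ρ e β R : Config A d G → ℝ) := by
  unfold restW
  exact continuous_finsetProd _ fun q _ =>
    Real.continuous_exp.comp (continuous_const.mul (continuous_plaqObs ρ hρ e q))

omit [Fintype A] [CompactSpace G] [MeasurableSpace G] [BorelSpace G] [SecondCountableTopology G] in
/-- The pair integrand is continuous. [folklore] -/
theorem continuous_pairIntegrand (hρ : Continuous ρ) (Q : Finset (Plaq A d)) (u v : Plaq A d) :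
    Continuous fun U : Config A d G =>
      plaqObs ρ e u U * plaqObs ρ e v U * ∏ q ∈ Q, gfac ρ e β q U :=
  ((continuous_plaqObs ρ hρ e u).mul (continuous_plaqObs ρ hρ e v)).mul
    (continuous_finsetProd _ fun q _ => continuous_gfac ρ e β hρ q)

omit [SecondCountableTopology G] in
/-- **Crude bound**: `|T_Q(u,v)| ≤ N² (2βN)^{|Q|}` for `0 ≤ β`, `βN ≤ 1`. [folklore] -/
theorem abs_pairT_le (hρ : Continuous ρ) (hβ : 0 ≤ β) (hβN : β * N ≤ 1)
    (Q : Finset (Plaq A d)) (u v : Plaq A d) :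
    |pairT ρ e β Q u v| ≤ N ^ 2 * (2 * β * N) ^ Q.card := by
  haveI := isProbabilityMeasure_productHaar (A := A) (d := d) (G := G)
  unfold pairT
  have hbd : ∀ U : Config A d G, ‖plaqObs ρ e u U * plaqObs ρ e v U *
      ∏ q ∈ Q, gfac ρ e β q U‖ ≤ N ^ 2 * (2 * β * N) ^ Q.card := fun U => by
    rw [Real.norm_eq_abs, abs_mul, abs_mul, abs_prod]
    have hP := abs_plaqObs_le ρ hρ e u U
    have hQ := abs_plaqObs_le ρ hρ e v U
    have hprod : ∏ q ∈ Q, |gfac ρ e β q U| ≤ (2 * β * N) ^ Q.card := by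
      rw [← prod_const]
      exact prod_le_prod (fun q _ => abs_nonneg _) fun q _ => abs_gfac_le ρ e β hρ hβ hβN q U
    calc |plaqObs ρ e u U| * |plaqObs ρ e v U| * ∏ q ∈ Q, |gfac ρ e β q U|
        ≤ N * N * (2 * β * N) ^ Q.card :=
          mul_le_mul (mul_le_mul hP hQ (abs_nonneg _) (Nat.cast_nonneg _)) hprod
            (prod_nonneg fun q _ => abs_nonneg _) (by positivity)
      _ = N ^ 2 * (2 * β * N) ^ Q.card := by ring
  have h := norm_integral_le_of_norm_le_const (μ := productHaar A d G) (ae_of_all _ hbd)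
  rwa [probReal_univ, mul_one, Real.norm_eq_abs] at h

omit [SecondCountableTopology G] in
/-- `T_Q(u,v) = T_Q(v,u)`. [folklore] -/
theorem pairT_comm (Q : Finset (Plaq A d)) (u v : Plaq A d) :
    pairT ρ e β Q u v = pairT ρ e β Q v u := by
  unfold pairT
  exact integral_congr_ae (ae_of_all _ fun U => by ring)

/-! ## The cluster expansion of the rest weight and of a difference form -/

omit [Fintype A] [TopologicalSpace G] [IsTopologicalGroup G] [CompactSpace G] [MeasurableSpace G]
  [BorelSpace G] in
/-- `∏_{q ∈ R} e^{β Re tr ρ(U_q)} = ∑_{Q ⊆ R} ∏_{q ∈ Q} g_q`. [folklore] -/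
theorem restW_eq_sum_prod_gfac (R : Finset (Plaq A d)) (U : Config A d G) :
    restW ρ e β R U = ∑ Q ∈ R.powerset, ∏ q ∈ Q, gfac ρ e β q U := by
  classical
  unfold restW
  have h1 : (fun q => Real.exp (β * plaqObs ρ e q U)) = fun q => gfac ρ e β q U + 1 := by
    funext q; unfold gfac; ring
  rw [h1, prod_add]
  simp

/-- **The difference form is a finite sum of pair terms**: for plaquettes `a, b, c, c'` and a
finite set `R` of rest plaquettes,
`∫ (W_a - W_b)(W_c - W_c') ∏_{q ∈ R} e^{β W_q} ∏ dU = ∑_{Q ⊆ R} (T_Q(a,c) - T_Q(a,c') - T_Q(b,c) + T_Q(b,c'))`.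
[folklore] -/
theorem integral_diff_mul_diff_restW_eq_sum (hρ : Continuous ρ) (R : Finset (Plaq A d))
    (a b c c' : Plaq A d) :
    ∫ U, (plaqObs ρ e a U - plaqObs ρ e b U) * (plaqObs ρ e c U - plaqObs ρ e c' U) *
        restW ρ e β R U ∂(productHaar A d G) =
      ∑ Q ∈ R.powerset, (pairT ρ e β Q a c - pairT ρ e β Q a c' -
        pairT ρ e β Q b c + pairT ρ e β Q b c') := by
  set π : Measure (Config A d G) := productHaar A d G with hπ
  have hI : ∀ (Q : Finset (Plaq A d)) (x y : Plaq A d), Integrable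
      (fun U : Config A d G => plaqObs ρ e x U * plaqObs ρ e y U * ∏ q ∈ Q, gfac ρ e β q U) π :=
    fun Q x y => TwistedSlab.integrable_config_of_continuous (continuous_pairIntegrand ρ e β hρ Q x y)
  have hterm : ∀ Q : Finset (Plaq A d),
      ∫ U, (plaqObs ρ e a U - plaqObs ρ e b U) * (plaqObs ρ e c U - plaqObs ρ e c' U) *
          ∏ q ∈ Q, gfac ρ e β q U ∂π =
      pairT ρ e β Q a c - pairT ρ e β Q a c' - pairT ρ e β Q b c + pairT ρ e β Q b c' := by
    intro Q
    have hAC := hI Q a c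
    have hAC' := hI Q a c'
    have hBC := hI Q b c
    have hBC' := hI Q b c'
    have h12 : Integrable (fun U : Config A d G =>
        plaqObs ρ e a U * plaqObs ρ e c U * ∏ q ∈ Q, gfac ρ e β q U -
          plaqObs ρ e a U * plaqObs ρ e c' U * ∏ q ∈ Q, gfac ρ e β q U) π := hAC.sub hAC'
    have h123 : Integrable (fun U : Config A d G =>
        plaqObs ρ e a U * plaqObs ρ e c U * ∏ q ∈ Q, gfac ρ e β q U -
          plaqObs ρ e a U * plaqObs ρ e c' U * ∏ q ∈ Q, gfac ρ e β q U -
          plaqObs ρ e b U * plaqObs ρ e c U * ∏ q ∈ Q, gfac ρ e β q U) π := h12.sub hBC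
    unfold pairT
    rw [← hπ, ← integral_sub hAC hAC', ← integral_sub h12 hBC, ← integral_add h123 hBC']
    exact integral_congr_ae (ae_of_all _ fun U => by ring)
  have hIt : ∀ Q : Finset (Plaq A d), Integrable
      (fun U : Config A d G => (plaqObs ρ e a U - plaqObs ρ e b U) *
        (plaqObs ρ e c U - plaqObs ρ e c' U) * ∏ q ∈ Q, gfac ρ e β q U) π := fun Q =>
    TwistedSlab.integrable_config_of_continuous ((((continuous_plaqObs ρ hρ e a).sub
      (continuous_plaqObs ρ hρ e b)).mul ((continuous_plaqObs ρ hρ e c).sub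
      (continuous_plaqObs ρ hρ e c'))).mul
      (continuous_finsetProd _ fun q _ => continuous_gfac ρ e β hρ q))
  simp_rw [restW_eq_sum_prod_gfac, mul_sum]
  rw [integral_finsetSum _ fun Q _ => hIt Q]
  exact sum_congr rfl fun Q _ => hterm Q

/-! ## Tail bounds -/

omit [SecondCountableTopology G] in
/-- **Tail bound**: `|∑_{Q ⊆ R, n < |Q|} T_Q(u,v)| ≤ 2^{|R|} N² (2βN)^{n+1}` for `0 ≤ β`,
`2βN ≤ 1`. [folklore] -/
theorem abs_sum_pairT_filter_lt_card_le (hρ : Continuous ρ) (hβ : 0 ≤ β) (hγ : 2 * β * N ≤ 1)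
    (R : Finset (Plaq A d)) (u v : Plaq A d) (n : ℕ) :
    |∑ Q ∈ R.powerset.filter (fun Q => n < Q.card), pairT ρ e β Q u v| ≤
      2 ^ R.card * (N ^ 2 * (2 * β * N) ^ (n + 1)) := by
  have hN : (0 : ℝ) ≤ N := Nat.cast_nonneg _
  have hβN : β * N ≤ 1 := by nlinarith
  have hγ0 : 0 ≤ 2 * β * N := by positivity
  have hterm : ∀ Q ∈ R.powerset.filter (fun Q => n < Q.card),
      |pairT ρ e β Q u v| ≤ N ^ 2 * (2 * β * N) ^ (n + 1) := by
    intro Q hQ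
    have hn : n + 1 ≤ Q.card := (mem_filter.1 hQ).2
    refine (abs_pairT_le ρ e β hρ hβ hβN Q u v).trans ?_
    exact mul_le_mul_of_nonneg_left (pow_le_pow_of_le_one hγ0 hγ hn) (by positivity)
  calc |∑ Q ∈ R.powerset.filter (fun Q => n < Q.card), pairT ρ e β Q u v|
      ≤ ∑ Q ∈ R.powerset.filter (fun Q => n < Q.card), |pairT ρ e β Q u v| :=
        abs_sum_le_sum_abs _ _
    _ ≤ ∑ _Q ∈ R.powerset.filter (fun Q => n < Q.card), N ^ 2 * (2 * β * N) ^ (n + 1) :=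
        sum_le_sum hterm
    _ = ((R.powerset.filter (fun Q => n < Q.card)).card : ℝ) * (N ^ 2 * (2 * β * N) ^ (n + 1)) := by
        rw [sum_const, nsmul_eq_mul]
    _ ≤ 2 ^ R.card * (N ^ 2 * (2 * β * N) ^ (n + 1)) := by
        refine mul_le_mul_of_nonneg_right ?_ (by positivity)
        have h1 : ((R.powerset.filter (fun Q => n < Q.card)).card : ℝ) ≤ (R.powerset.card : ℝ) := by
          exact_mod_cast card_filter_le _ _
        rw [card_powerset] at h1
        exact_mod_cast h1

omit [SecondCountableTopology G] in
/-- **Splitting the expansion at order `n`**: the full sum over `Q ⊆ R` is the sum over `|Q| ≤ n`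
plus a tail bounded by `2^{|R|} N² (2βN)^{n+1}`. [folklore] -/
theorem abs_sum_pairT_sub_sum_filter_le (hρ : Continuous ρ) (hβ : 0 ≤ β) (hγ : 2 * β * N ≤ 1)
    (R : Finset (Plaq A d)) (u v : Plaq A d) (n : ℕ) :
    |∑ Q ∈ R.powerset, pairT ρ e β Q u v -
        ∑ Q ∈ R.powerset.filter (fun Q => Q.card ≤ n), pairT ρ e β Q u v| ≤
      2 ^ R.card * (N ^ 2 * (2 * β * N) ^ (n + 1)) := by
  have hsplit := (sum_filter_add_sum_filter_not R.powerset (fun Q => Q.card ≤ n)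
    (fun Q => pairT ρ e β Q u v))
  have hnot : R.powerset.filter (fun Q => ¬ Q.card ≤ n) =
      R.powerset.filter (fun Q => n < Q.card) :=
    filter_congr fun Q _ => by simp only [not_le]
  rw [← hsplit, add_sub_cancel_left, hnot]
  exact abs_sum_pairT_filter_lt_card_le ρ e β hρ hβ hγ R u v n

end PairExp

end TiltedRP

end Summit.QuantumFields.GaugeBoot

end
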